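import Summits.AtomisticToContinuum.FouriersLaw.Theses.OddSectorIrreversibility
import Literature.Barriers.AtomisticToContinuum.MazurBoundBallisticOpenChain

/-!
# `SubBallisticWindow` / Negative (1/2): the closed kernel is the Hamiltonian flow; flow calculus; `{H, Σ w_k h_k}`

Negative-side structure for crux `stmt-AtomisticToContinuum-14070`
(`Summit.AtomisticToContinuum.FouriersLaw.Theses.OddSectorIrreversibility.SubBallisticWindow`, E2 of route
OddSectorIrreversibility), from the standing disprover's `Cruxes/SubBallisticWindow/Disproof.lean` (cycle 1).
Sorry-free; no `Prop`-valued definitions; nothing here closes the item.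

* `closedKernel_eq_dirac`, `integral_closedKernel` — the closed kernels `(pinnedChain ω₂ lam β 0).transitionKernel`
  (zero friction ⇒ zero noise amplitude) are Dirac masses at the constructed flow `closedFlow t x = chainFlow N x 0 t`.
* Flow calculus of the closed pinned chain (`ω₂ > 0`, `lam, β ≥ 0`): `hasDerivAt_closedFlow` (Hamilton's equations
  for `t > 0`, from `pinnedChain_isIntegralSolutionOn_chainFlow` + FTC), `hasDerivAt_comp_closedFlow`
  (`d/dt f∘Φ_t = {H,f}∘Φ_t`), `comp_closedFlow_sub_eq_integral` (FTC along the flow, `f ∈ C²`),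
  `hamiltonian_closedFlow` (energy conservation).
* `weightedEnergy`, `poisson_hamiltonian_weightedEnergy` — `{H, ∑_k w_k h_k} = ∑_k (w_{k+1} - w_k) j_k` for every
  weight sequence `w : ℕ → ℝ` (site energies with the bond terms split evenly; generalises the catalogue's
  `MazurBoundBallisticOpenChain.poisson_hamiltonian_energyMoment`, `w_k = k`).
Part 2 (`FixedN.lean`) turns this into `Q_B(τ) = W_B∘Φ_τ - W_B` and the crux at fixed `N`.
-/
noncomputable section

open MeasureTheory Filter Topology Set
open scoped NNReal ContDiff
open Literature.MathematicalPhysics.KineticTheory.HeatConduction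
open Literature.Probability.Process

namespace Summit.AtomisticToContinuum.FouriersLaw.Theorems.SubBallisticWindow.Negative.ClosedFlow

open Summit.AtomisticToContinuum.FouriersLaw.Theses.OddSectorIrreversibility

variable {ω₂ lam β : ℝ}

/-! ## §1 The closed kernel is the Dirac mass at the Hamiltonian flow (no junk) -/

/-- The CLOSED flow `Φ_t(x)`: the constructed pathwise flow of `pinnedChain ω₂ lam β 0` with zero noise. [folklore] -/
def closedFlow (ω₂ lam β : ℝ) (N : ℕ) (t : ℝ) (x : PhaseSpace N) : PhaseSpace N :=
  (pinnedChain ω₂ lam β 0).chainFlow N x (fun _ => 0) t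

/-- Zero amplitudes give the zero noise path. [folklore] -/
theorem chainNoise_zero_amp (N : ℕ) (w : WienerPair) : chainNoise N 0 0 w = fun _ => 0 := by
  funext t i
  simp [chainNoise]

/-- At `γ = 0` the solution map ignores the Brownian pair: it is the closed flow. [folklore] -/
theorem closed_solMap_eq (ω₂ lam β : ℝ) (N : ℕ) (T_L T_R t : ℝ) (x : PhaseSpace N) (w : WienerPair) :
    (pinnedChain ω₂ lam β 0).solMap N T_L T_R t x w = closedFlow ω₂ lam β N t x := by
  unfold OscillatorChain.solMap closedFlow
  have hγ : (pinnedChain ω₂ lam β 0).γ = 0 := rfl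
  simp only [hγ, mul_zero, zero_mul, Real.sqrt_zero, chainNoise_zero_amp]


/-- **Closed kernel = Dirac at the flow** (`ω₂ > 0`, `lam, β ≥ 0`, any nominal temperatures). [folklore] -/
theorem closedKernel_eq_dirac (hω : 0 < ω₂) (hl : 0 ≤ lam) (hβ : 0 ≤ β) (N : ℕ) (T_L T_R : ℝ)
    (t : ℝ≥0) (x : PhaseSpace N) :
    (pinnedChain ω₂ lam β 0).transitionKernel N T_L T_R t x = Measure.dirac (closedFlow ω₂ lam β N t x) := by
  rw [pinnedChain_transitionKernel_apply hω hl hβ le_rfl]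
  simp_rw [closed_solMap_eq]
  rw [Measure.map_const, measure_univ, one_smul]

/-- Integration against the closed kernel is evaluation along the flow. [folklore] -/
theorem integral_closedKernel (hω : 0 < ω₂) (hl : 0 ≤ lam) (hβ : 0 ≤ β) (N : ℕ) (T_L T_R : ℝ)
    (t : ℝ≥0) (x : PhaseSpace N) (F : PhaseSpace N → ℝ) :
    ∫ y, F y ∂((pinnedChain ω₂ lam β 0).transitionKernel N T_L T_R t x) = F (closedFlow ω₂ lam β N t x) := by
  rw [closedKernel_eq_dirac hω hl hβ, integral_dirac]

/-! ## §2 Flow calculus of the closed chain: ODE, chain rule, FTC, energy conservation -/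

section FlowCalculus

variable (hω : 0 < ω₂) (hl : 0 ≤ lam) (hβ : 0 ≤ β) (N : ℕ)
include hω hl hβ

omit hω hl hβ in
/-- `Φ_0 = id`. [folklore] -/
theorem closedFlow_zero (x : PhaseSpace N) : closedFlow ω₂ lam β N 0 x = x := by
  unfold closedFlow
  rw [pinnedChain_chainFlow_of_nonpos ω₂ lam β 0 N x continuous_const le_rfl]
  simp

/-- The closed flow is continuous in time. [folklore] -/
theorem continuous_closedFlow (x : PhaseSpace N) : Continuous fun t => closedFlow ω₂ lam β N t x := by
  unfold closedFlow
  exact pinnedChain_continuous_chainFlow hω hl hβ le_rfl N x continuous_const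

/-- **The closed flow solves Hamilton's equations**: `d/dt Φ_t(x) = Y(Φ_t(x))` for `t > 0`, `Y` the
drift of `pinnedChain ω₂ lam β 0` (no friction). [folklore] -/
theorem hasDerivAt_closedFlow (x : PhaseSpace N) {t : ℝ} (ht : 0 < t) :
    HasDerivAt (fun s => closedFlow ω₂ lam β N s x)
      ((pinnedChain ω₂ lam β 0).drift N (closedFlow ω₂ lam β N t x)) t := by
  set P := pinnedChain ω₂ lam β 0 with hP
  have hsol := pinnedChain_isIntegralSolutionOn_chainFlow hω hl hβ le_rfl N x
    (continuous_const : Continuous fun _ : ℝ => (0 : Fin N → ℝ)) (t + 1)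
  have hcont : Continuous fun s => P.drift N (closedFlow ω₂ lam β N s x) :=
    (pinnedChain_contDiff_drift ω₂ lam β 0 N (n := 0)).continuous.comp (continuous_closedFlow hω hl hβ N x)
  have hG : HasDerivAt (fun s => x + ∫ u in (0 : ℝ)..s, P.drift N (closedFlow ω₂ lam β N u x))
      (P.drift N (closedFlow ω₂ lam β N t x)) t := by
    have h := intervalIntegral.integral_hasDerivAt_right (hcont.intervalIntegrable 0 t)
      (hcont.stronglyMeasurableAtFilter volume (𝓝 t)) hcont.continuousAt
    exact h.const_add x
  refine hG.congr_of_eventuallyEq ?_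
  have hmem : Ioo 0 (t + 1) ∈ 𝓝 t := Ioo_mem_nhds ht (by linarith)
  filter_upwards [hmem] with s hs
  have h := hsol s ⟨hs.1.le, hs.2.le⟩
  have hf : OscillatorChain.forcing x (fun _ : ℝ => (0 : Fin N → ℝ)) s = x := by
    simp [OscillatorChain.forcing]
  rw [hf] at h
  exact h

omit hω hl hβ in
/-- `Y·∇f = {H, f}` for the frictionless chain (generator at `γ = 0` is the Poisson bracket). [folklore] -/
theorem fderiv_drift_eq_poisson {f : PhaseSpace N → ℝ} (hf : Differentiable ℝ f) (y : PhaseSpace N) :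
    fderiv ℝ f y ((pinnedChain ω₂ lam β 0).drift N y) =
      poisson ((pinnedChain ω₂ lam β 0).hamiltonian N) f y := by
  have h1 := (pinnedChain ω₂ lam β 0).generator_eq_fderiv_drift_add N 0 0 hf y
  have h2 := Literature.Barriers.AtomisticToContinuum.OpenChain.generator_eq_poisson_of_gamma_eq_zero
    (pinnedChain ω₂ lam β 0) rfl N 0 0 f y
  have hγ : (pinnedChain ω₂ lam β 0).γ = 0 := rfl
  rw [hγ, zero_mul, add_zero] at h1
  rw [← h1, h2]

/-- **Chain rule along the closed flow**: `d/dt f(Φ_t x) = {H, f}(Φ_t x)` for differentiable `f`, `t > 0`. [folklore] -/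
theorem hasDerivAt_comp_closedFlow {f : PhaseSpace N → ℝ} (hf : Differentiable ℝ f) (x : PhaseSpace N)
    {t : ℝ} (ht : 0 < t) :
    HasDerivAt (fun s => f (closedFlow ω₂ lam β N s x))
      (poisson ((pinnedChain ω₂ lam β 0).hamiltonian N) f (closedFlow ω₂ lam β N t x)) t := by
  have h := (hf (closedFlow ω₂ lam β N t x)).hasFDerivAt.comp_hasDerivAt t
    (hasDerivAt_closedFlow hω hl hβ N x ht)
  rw [fderiv_drift_eq_poisson N hf] at h
  exact h

/-- **FTC along the closed flow**: `f(Φ_τ x) - f(x) = ∫₀^τ {H, f}(Φ_t x) dt` for `f ∈ C²`, `τ ≥ 0`. [folklore] -/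
theorem comp_closedFlow_sub_eq_integral {f : PhaseSpace N → ℝ} (hf : ContDiff ℝ 2 f) (x : PhaseSpace N)
    {τ : ℝ} (hτ : 0 ≤ τ) :
    f (closedFlow ω₂ lam β N τ x) - f x =
      ∫ t in (0 : ℝ)..τ, poisson ((pinnedChain ω₂ lam β 0).hamiltonian N) f (closedFlow ω₂ lam β N t x) := by
  have hfd : Differentiable ℝ f := hf.differentiable (by norm_num)
  have hHc : ContDiff ℝ 2 ((pinnedChain ω₂ lam β 0).hamiltonian N) := pinnedChain_contDiff_hamiltonian ω₂ lam β 0 N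
  have hpc : Continuous (poisson ((pinnedChain ω₂ lam β 0).hamiltonian N) f) :=
    (differentiable_poisson hHc hf).continuous
  have hcont : ContinuousOn (fun s => f (closedFlow ω₂ lam β N s x)) (Icc 0 τ) :=
    (hfd.continuous.comp (continuous_closedFlow hω hl hβ N x)).continuousOn
  have hderiv : ∀ s ∈ Ioo 0 τ, HasDerivAt (fun s => f (closedFlow ω₂ lam β N s x))
      (poisson ((pinnedChain ω₂ lam β 0).hamiltonian N) f (closedFlow ω₂ lam β N s x)) s :=
    fun s hs => hasDerivAt_comp_closedFlow hω hl hβ N hfd x hs.1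
  have hint : IntervalIntegrable (fun s => poisson ((pinnedChain ω₂ lam β 0).hamiltonian N) f
      (closedFlow ω₂ lam β N s x)) volume 0 τ :=
    (hpc.comp (continuous_closedFlow hω hl hβ N x)).intervalIntegrable 0 τ
  have h := intervalIntegral.integral_eq_sub_of_hasDerivAt_of_le hτ hcont hderiv hint
  rw [h, closedFlow_zero N x]

/-- **Energy conservation** along the closed flow: `H(Φ_τ x) = H(x)` for `τ ≥ 0`. [folklore] -/
theorem hamiltonian_closedFlow (x : PhaseSpace N) {τ : ℝ} (hτ : 0 ≤ τ) :
    (pinnedChain ω₂ lam β 0).hamiltonian N (closedFlow ω₂ lam β N τ x) =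
      (pinnedChain ω₂ lam β 0).hamiltonian N x := by
  have h := comp_closedFlow_sub_eq_integral hω hl hβ N (pinnedChain_contDiff_hamiltonian ω₂ lam β 0 N) x hτ
  simp only [poisson_self, intervalIntegral.integral_zero] at h
  linarith

end FlowCalculus


/-! ## §3a Weighted site energies and their Poisson bracket with `H`: `{H, W_w} = ∑_k (w_{k+1} - w_k) j_k` -/

section Weighted

variable (P : OscillatorChain) {N : ℕ}

/-- Weighted site energies `W_w = ∑_k w_k h_k`, `h_k = p_k²/2 + U(q_k) + ½V(q_{k+1}-q_k) + ½V(q_k-q_{k-1})`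
(bond energies split evenly), for a weight sequence `w : ℕ → ℝ`; written as
`∑_k w_k (p_k²/2 + U(q_k)) + ∑_{l = k+1} ((w_k + w_l)/2) V(q_l - q_k)`. [folklore] -/
def weightedEnergy (w : ℕ → ℝ) (N : ℕ) (x : PhaseSpace N) : ℝ :=
  (∑ k : Fin N, w k.val * (x.2 k ^ 2 / 2 + P.U (x.1 k))) +
    ∑ k : Fin N, ∑ l : Fin N,
      if l.val = k.val + 1 then ((w k.val + w l.val) / 2) * P.V (x.1 l - x.1 k) else 0

/-- `∂_{p_i} W_w = w_i p_i`. [folklore] -/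
theorem partialP_weightedEnergy (w : ℕ → ℝ) (i : Fin N) (x : PhaseSpace N) :
    partialP i (weightedEnergy P w N) x = w i.val * x.2 i := by
  unfold partialP weightedEnergy
  have h1 : HasDerivAt (fun t : ℝ => ∑ k : Fin N,
      w k.val * ((Function.update x.2 i t k) ^ 2 / 2 + P.U (x.1 k)))
      (∑ k : Fin N, if k = i then w i.val * x.2 i else 0) (x.2 i) := by
    apply HasDerivAt.fun_sum
    intro k _
    by_cases hk : k = i
    · subst hk
      simp only [Function.update_self, if_true]
      have h' : HasDerivAt (fun t : ℝ => t ^ 2 / 2 + P.U (x.1 k)) (x.2 k) (x.2 k) := by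
        have h := ((hasDerivAt_pow 2 (x.2 k)).div_const 2).add_const (P.U (x.1 k))
        have he : ((2 : ℕ) : ℝ) * x.2 k ^ (2 - 1) / 2 = x.2 k := by norm_num
        rwa [he] at h
      exact h'.const_mul _
    · simp only [Function.update_of_ne hk, hk, if_false]
      exact hasDerivAt_const _ _
  have h2 : HasDerivAt (fun _ : ℝ => ∑ k : Fin N, ∑ l : Fin N,
      if l.val = k.val + 1 then ((w k.val + w l.val) / 2) * P.V (x.1 l - x.1 k) else 0) 0 (x.2 i) :=
    hasDerivAt_const _ _
  have h := h1.add h2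
  simp only [Finset.sum_ite_eq', Finset.mem_univ, if_true, add_zero] at h
  exact h.deriv

/-- Closed form of `∂_{q_i} W_w`. [folklore] -/
def dWeightedEnergy (w : ℕ → ℝ) (N : ℕ) (i : Fin N) (q : Fin N → ℝ) : ℝ :=
  w i.val * deriv P.U (q i) + ∑ k : Fin N, ∑ l : Fin N,
    if l.val = k.val + 1 then
      ((w k.val + w l.val) / 2) * deriv P.V (q l - q k) *
        ((if l = i then 1 else 0) - (if k = i then 1 else 0)) else 0

/-- `∂_{q_i} W_w = dWeightedEnergy` for differentiable potentials. [folklore] -/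
theorem partialQ_weightedEnergy (hU : Differentiable ℝ P.U) (hV : Differentiable ℝ P.V)
    (w : ℕ → ℝ) (i : Fin N) (x : PhaseSpace N) :
    partialQ i (weightedEnergy P w N) x = dWeightedEnergy P w N i x.1 := by
  unfold partialQ weightedEnergy dWeightedEnergy
  have h1 : HasDerivAt (fun t : ℝ => ∑ k : Fin N,
      w k.val * (x.2 k ^ 2 / 2 + P.U (Function.update x.1 i t k)))
      (∑ k : Fin N, if k = i then w i.val * deriv P.U (x.1 i) else 0) (x.1 i) := by
    apply HasDerivAt.fun_sum
    intro k _
    by_cases hk : k = i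
    · subst hk
      simp only [Function.update_self, if_true]
      exact (((hU _).hasDerivAt).const_add _).const_mul _
    · simp only [Function.update_of_ne hk, hk, if_false]
      exact hasDerivAt_const _ _
  have h2 : HasDerivAt (fun t : ℝ => ∑ k : Fin N, ∑ l : Fin N,
      if l.val = k.val + 1 then ((w k.val + w l.val) / 2) * P.V (Function.update x.1 i t l -
        Function.update x.1 i t k) else 0)
      (∑ k : Fin N, ∑ l : Fin N, if l.val = k.val + 1 then
        ((w k.val + w l.val) / 2) * deriv P.V (x.1 l - x.1 k) *
          ((if l = i then 1 else 0) - (if k = i then 1 else 0)) else 0) (x.1 i) := by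
    refine HasDerivAt.fun_sum fun k _ => HasDerivAt.fun_sum fun l _ => ?_
    by_cases hlk : l.val = k.val + 1
    · simp only [if_pos hlk]
      have ha : HasDerivAt (fun t => Function.update x.1 i t l - Function.update x.1 i t k)
          ((if l = i then 1 else 0) - (if k = i then 1 else 0)) (x.1 i) := by
        refine HasDerivAt.sub ?_ ?_
        · by_cases hl : l = i
          · subst hl; simp only [Function.update_self, if_true]; exact hasDerivAt_id _
          · simp only [Function.update_of_ne hl, hl, if_false]; exact hasDerivAt_const _ _
        · by_cases hk : k = i
          · subst hk; simp only [Function.update_self, if_true]; exact hasDerivAt_id _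
          · simp only [Function.update_of_ne hk, hk, if_false]; exact hasDerivAt_const _ _
      have hcomp := ((hV _).hasDerivAt).comp (x.1 i) ha
      have heval : Function.update x.1 i (x.1 i) l - Function.update x.1 i (x.1 i) k =
          x.1 l - x.1 k := by simp
      rw [heval] at hcomp
      have := hcomp.const_mul ((w k.val + w l.val) / 2)
      rw [← mul_assoc] at this
      exact this
    · simp only [hlk, if_false]
      exact hasDerivAt_const _ _
  have h := h1.add h2
  simp only [Finset.sum_ite_eq', Finset.mem_univ, if_true] at h
  exact h.deriv

/-- **`{H, W_w} = ∑_k (w_{k+1} - w_k) j_k`**: the Poisson bracket of the Hamiltonian with the weighted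
site energies is the weighted sum of bond currents with the DISCRETE GRADIENT of the weights (local
energy balance `ḣ_k = j_{k-1} - j_k` summed by parts; free ends). Generalises
`poisson_hamiltonian_energyMoment` (`w_k = k`). [folklore] -/
theorem poisson_hamiltonian_weightedEnergy (hU : Differentiable ℝ P.U) (hV : Differentiable ℝ P.V)
    (w : ℕ → ℝ) (N : ℕ) (x : PhaseSpace N) :
    poisson (P.hamiltonian N) (weightedEnergy P w N) x =
      ∑ k : Fin N, (w (k.val + 1) - w k.val) * P.bondCurrent N k x := by
  unfold poisson
  simp only [P.partialP_hamiltonian, P.partialQ_hamiltonian_eq_dPotential hU hV,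
    partialP_weightedEnergy P, partialQ_weightedEnergy P hU hV]
  have key : ∀ i : Fin N,
      x.2 i * dWeightedEnergy P w N i x.1 - P.dPotential N i x.1 * (w i.val * x.2 i) =
        ∑ k : Fin N, ∑ l : Fin N, if l.val = k.val + 1 then
          x.2 i * deriv P.V (x.1 l - x.1 k) * (((w k.val + w l.val) / 2 - w i.val) *
            ((if l = i then 1 else 0) - (if k = i then 1 else 0))) else 0 := by
    intro i
    unfold dWeightedEnergy OscillatorChain.dPotential
    set A := ∑ k : Fin N, ∑ l : Fin N, (if l.val = k.val + 1 then
      ((w k.val + w l.val) / 2) * deriv P.V (x.1 l - x.1 k) *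
        ((if l = i then 1 else 0) - (if k = i then 1 else 0)) else 0) with hA
    set B := ∑ k : Fin N, ∑ l : Fin N, (if l.val = k.val + 1 then
      deriv P.V (x.1 l - x.1 k) * ((if l = i then 1 else 0) - (if k = i then 1 else 0))
        else 0) with hB
    have h1 : x.2 i * (w i.val * deriv P.U (x.1 i) + A) -
        (deriv P.U (x.1 i) + B) * (w i.val * x.2 i) =
          x.2 i * A - (w i.val * x.2 i) * B := by ring
    rw [h1, hA, hB, Finset.mul_sum, Finset.mul_sum, ← Finset.sum_sub_distrib]
    refine Finset.sum_congr rfl fun k _ => ?_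
    rw [Finset.mul_sum, Finset.mul_sum, ← Finset.sum_sub_distrib]
    refine Finset.sum_congr rfl fun l _ => ?_
    split_ifs <;> ring
  simp only [key]
  rw [Finset.sum_comm]
  refine Finset.sum_congr rfl fun k _ => ?_
  rw [Finset.sum_comm]
  unfold OscillatorChain.bondCurrent
  rw [Finset.mul_sum]
  refine Finset.sum_congr rfl fun l _ => ?_
  rw [Finset.sum_ite_irrel, Finset.sum_const_zero]
  split_ifs with hlk
  · have hl : w l.val = w (k.val + 1) := by rw [hlk]
    simp only [mul_sub, Finset.sum_sub_distrib, mul_ite, mul_one, mul_zero,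
      Finset.sum_ite_eq, Finset.mem_univ, if_true]
    rw [hl]
    ring
  · simp

/-- `W_w` is smooth for smooth potentials. [folklore] -/
theorem contDiff_weightedEnergy {n : WithTop ℕ∞} (hU : ContDiff ℝ n P.U) (hV : ContDiff ℝ n P.V)
    (w : ℕ → ℝ) (N : ℕ) : ContDiff ℝ n (weightedEnergy P w N) := by
  unfold weightedEnergy
  refine ContDiff.add ?_ ?_
  · refine ContDiff.sum fun k _ => contDiff_const.mul (ContDiff.add ?_ ?_)
    · exact ((contDiff_apply ℝ ℝ k).comp contDiff_snd).pow 2 |>.div_const 2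
    · exact hU.comp ((contDiff_apply ℝ ℝ k).comp contDiff_fst)
  · refine ContDiff.sum fun k _ => ContDiff.sum fun l _ => ?_
    split_ifs
    · exact contDiff_const.mul (hV.comp
        (((contDiff_apply ℝ ℝ l).comp contDiff_fst).sub ((contDiff_apply ℝ ℝ k).comp contDiff_fst)))
    · exact contDiff_const

end Weighted


end Summit.AtomisticToContinuum.FouriersLaw.Theorems.SubBallisticWindow.Negative.ClosedFlow
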